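/-
Copyright (c) 2026 the pub-hodgecm-mathlib formalisation cell (harness21).  Prover seat hodgecm-mathlib-R90-C14-p01 (g0), R90-TF section S8 «ContSpec-n½» (dealer R90-CS-plan (g0),
TWIN-DAG v1 row 6, 2026-09-04T16:22:13Z ∕ ORDER 16:24:04Z), h413 = `stmt-HodgeConjecture-24833`: the `U(2,1)` ∕ PAIR-currency twin of ★ `K2E1ChiEisensteinDataCMTwo` (X1_χ §2a) — the CM
constant-term DATA of the `(χ₁, χ₂)` Bernstein–Lapid ball system of `U(2,1)_{L∕L⁺}`.
-/
import Summits.HodgeConjecture.HodgeConjecture.Theorems.K2E1ChiEisensteinSolvesXSystemU3            -- ★ row 4b (K2E1-p16): S2_χ `cnstN_iota_toHX_eisensteinSeriesU_eq_chi_cm_three`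
import Summits.HodgeConjecture.HodgeConjecture.Theorems.K2E1ChiEisensteinConstantTermCMThree         -- ★ row 2 (this seat, p861910): `borelConstantTerm_chiPairEisenstein_cm_three_eq_add_mul`
import Summits.HodgeConjecture.HodgeConjecture.Theorems.K2E1ChiConstantTermColumnsIndependentU3      -- ★ row 5 (this seat, p861875): `hLinj_cm_three_pair`, `ratBorel_mul_of_isChiSectionPair`; brings ★ U2 `zFun_sum_smul`, `coeFn_sum_smul_ae_eq`
import Summits.HodgeConjecture.HodgeConjecture.Theorems.K2E1ChiEisensteinDataCMTwo                   -- ★ X1_χ §2a (K2E1-p14): the rank-generic §1 `memLp_zFun_flatSectionU_of_norm_le` (reused by name)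
import Summits.HodgeConjecture.HodgeConjecture.Theorems.K2E1ChiEisensteinMemHXCMThree                -- ★ row 3 (K2E1-p16, p861780): section-generic `eisensteinSeriesU_flatSectionU_memHX_of_norm_le_cm_three`
import Summits.HodgeConjecture.HodgeConjecture.Theorems.K2E1SphericalEisensteinMeromorphicExportsU3   -- ★ X1₃: brings `iotaBound_cm_three`, `measure_setOf_lt_ne_top_cm_three`, `isFiniteMeasure_weightedTruncMeasure_cm_three`, the unfolding disintegration, `map_conj_toAdelic_eq_self_three`
import HarnessLib

/-!
# h413 ∕ Track B «K2-LIT» ∕ R90-TF S8 — `K2E1ChiEisensteinDataCMThree` (X1_χ §2a at `N = 3`, TWIN-DAG v1 row 6): THE CONSTANT-TERM DATA OF THE `(χ₁, χ₂)` BERNSTEIN–LAPID SYSTEM OF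
# `U(2,1)_{L∕L⁺}` AT THE CM PAIR — `α₁(z) = [f_z^φ]`, the columns `[f^{φ′_j}_{2−z}]` and their injective coordinate family `L(z)`, the Eisenstein datum `eX(z) = [E(f_z^φ)]`, and the
# α-SYSTEM `cnst_N(ι eX(z)) = α₁(z) + L(z)(bX(z))` on the Godement part `{2 < Re}` of every ball

Cell `pub/hodgecm-mathlib`, crux h413 = `stmt-HodgeConjecture-24833`, route of record `HCCMUnconditional`; programme R90-TF, section S8 (dealer R90-CS-plan (g0), R90 bus 2026-09-04T16:22:13Z
and ORDER 16:24:04Z; TWIN-DAG v1 `K2/K2E1-p16/g2/TWIN-DAG.v1.K2E1-p16-g2.md` fdfe4481de4f802d, row 6).  Prover seat `hodgecm-mathlib-R90-C14-p01` (g0).  THEOREMS ONLY (no `def`, no `instance`, no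
`notation`, no named-fact hypothesis, no `sorry`); lane `--kind proof --supports stmt-HodgeConjecture-24833 --as helper` (count-neutral).  Closes no socket.

WHAT CHANGES AT `N = 3` (w.r.t. ★ `K2E1ChiEisensteinDataCMTwo`).  (i) The character law is a PAIR (ruling S8-R10 (b), ★ D-S8-3 `IsChiSectionPair χ₁ χ₂`): the section `φ` is a
`(χ₁, χ₂)`-section with `χ₂` AUTOMORPHIC (left-`B(L⁺)`-invariance ★ `IsChiSectionPair.toAdelic_mul`), stated by the bare predicate (no section-space membership is consumed here), and the column
family `φ′_j` is any linearly independent family of continuous bounded `(χ₁′, χ₂′)`-sections with `χ₂′` automorphic (in the consumer's hands `(χ₁′, χ₂′) = (χ₁ʷ, χ₂) = (reflectChar c χ₁, χ₂)`, the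
`U(2,1)` Weyl dictionary of ★ row 4a `K2E1ChiIntertwinedSectionU3`; this file does not need the dictionary).  (ii) `2ρ_B = 2`: Godement part `{2 < Re}`, columns `[f^{φ′_j}_{2−z}]`, intertwined
coefficient `φ̃_z·H^{z−2}`, weight `k = n + 4` on the ball `D_n = ball 0 (n+2)` (the ★ `U3` suppliers' Sobolev choice).  (iii) No trace-zero datum `δ` (the `N = 3` square-integrability ★
`eisensteinSeriesU_flatSectionU_memHX_of_norm_le_cm_three` is section-generic and `δ`-free).  Everything else is the ★ `N = 2` proof re-keyed: `α₁`, the columns and `L` HOLOMORPHIC (★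
`differentiableOn_HN_of_ae_eq_zFun_flatSectionU` ∕ `_mul_cpow` with exponent map `2 − z`), `L(z)` INJECTIVE on `D_n ∩ {2 < Re}` (★ row 5 `hLinj_cm_three_pair`), the Eisenstein datum (★ row 3),
and the α-SYSTEM from ★ row 4b S2_χ `cnstN_iota_toHX_eisensteinSeriesU_eq_chi_cm_three` fed by ★ row 2's constant term, the ★ unfolding disintegration (`hconj` ★ `map_conj_toAdelic_eq_self_three`)
and the square-integrabilities ★ §1 of the `N = 2` file (rank-generic, reused by name).

THE MATHEMATICS [BernsteinLapid2019, §4 Claims 2 and 5, p. 10; MoeglinWaldspurger1995, II.1.7, IV.1.8] — as in the `N = 2` file, with `1 − z ↦ 2 − z`.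
HONEST LABEL: HC_CM is proved only modulo the 7 printed citations (2 remaining named inputs: hLiu418 = `stmt-HodgeConjecture-24832`, h413 = `stmt-HodgeConjecture-24833`) until rung 0
closes; count-neutral helper, closes no socket; letters: NONE beyond the structural binders and the coordinate identity `hbX`.

## References
* [BernsteinLapid2019] J. Bernstein, E. Lapid, *On the meromorphic continuation of Eisenstein series*, J. Amer. Math. Soc. 37 (2024) (arXiv:1911.02342), §4 Claims 2, 5, p. 10.
* [MoeglinWaldspurger1995] C. Mœglin, J.-L. Waldspurger, *Spectral Decomposition and Eisenstein Series* (1995), I.2.13, II.1.7, IV.1.8.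
* [Rogawski1990] J. D. Rogawski, *Automorphic Representations of Unitary Groups in Three Variables*, Ann. of Math. Stud. 123 (1990), §13.9 p. 229.
-/

set_option autoImplicit false
-- the mandated namespace repeats `HodgeConjecture.HodgeConjecture`, as in every `Theorems/*.lean` of this sub-problem
set_option linter.dupNamespace false

noncomputable section

open MeasureTheory Filter Topology Set NumberField IsDedekindDomain
open scoped NNReal ENNReal Classical ComplexConjugate
open Literature.MeasureTheory.Group Literature.NumberTheory Literature.NumberTheory.Automorphic Literature.NumberTheory.Automorphic.UnitaryGroup AdelicGroupData
open Literature.NumberTheory.Automorphic.Arthur2013.Leaves.TECR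
open Literature.NumberTheory.GaloisRepresentations (HeckeCharacter)
open Summit.HodgeConjecture.HodgeConjecture.Cruxes.H413.K2E1BorelEisensteinU
open Summit.HodgeConjecture.HodgeConjecture.Cruxes.H413.K2E1BLBorelSpacesU2Defs
open Summit.HodgeConjecture.HodgeConjecture.Cruxes.H413.K2E1BLBorelOperatorsU2Defs
open Summit.HodgeConjecture.HodgeConjecture.Cruxes.H413.K2E1CharacterEisensteinU3PairDefs (IsChiSectionPair)
open Summit.HodgeConjecture.HodgeConjecture.Cruxes.H413.K2E1ChiEisensteinSolvesXSystemU3 (cnstN_iota_toHX_eisensteinSeriesU_eq_chi_cm_three)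
open Summit.HodgeConjecture.HodgeConjecture.Cruxes.H413.K2E1ChiEisensteinConstantTermCMThree (borelConstantTerm_chiPairEisenstein_cm_three_eq_add_mul)
open Summit.HodgeConjecture.HodgeConjecture.Cruxes.H413.K2E1ChiConstantTermColumnsIndependentU2 (zFun_sum_smul coeFn_sum_smul_ae_eq)
open Summit.HodgeConjecture.HodgeConjecture.Cruxes.H413.K2E1ChiConstantTermColumnsIndependentU3 (hLinj_cm_three_pair ratBorel_mul_of_isChiSectionPair)
open Summit.HodgeConjecture.HodgeConjecture.Cruxes.H413.K2E1ChiEisensteinDataCMTwo (memLp_zFun_flatSectionU_of_norm_le)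
open Summit.HodgeConjecture.HodgeConjecture.Cruxes.H413.K2E1ChiFlatSectionHNHolomorphicU2 (differentiableOn_HN_of_ae_eq_zFun_flatSectionU differentiableOn_HN_of_ae_eq_mul_cpow norm_zFun_le zFun_flatSectionU)
open Summit.HodgeConjecture.HodgeConjecture.Cruxes.H413.K2E1ChiEisensteinMemHXCMThree (eisensteinSeriesU_flatSectionU_memHX_of_norm_le_cm_three)
open Summit.HodgeConjecture.HodgeConjecture.Cruxes.H413.K2E1BLHeightPowerHolomorphicU2 (borelQuotHeight_pos)
open Summit.HodgeConjecture.HodgeConjecture.Cruxes.H413.K2E1BLInvariantSigmaDescentU (measurable_zFun_of_measurable)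
open Summit.HodgeConjecture.HodgeConjecture.Cruxes.H413.K2E1BLIotaClosedEmbeddingU3 (iotaBound_cm_three isFiniteMeasure_weightedTruncMeasure_cm_three)
open Summit.HodgeConjecture.HodgeConjecture.Cruxes.H413.K2E1SphericalEisensteinMeromorphicSuppliersU3 (measure_setOf_lt_ne_top_cm_three)
open Summit.HodgeConjecture.HodgeConjecture.Cruxes.H413.K2E1BLFibreAverageInvarianceU (integral_zFun_borelConstantTerm_eq_of_unfolding)
open Summit.HodgeConjecture.HodgeConjecture.Cruxes.H413.K2E1IntertwinedSectionInvariance (map_conj_toAdelic_eq_self_three)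

namespace Summit.HodgeConjecture.HodgeConjecture.Cruxes.H413.K2E1ChiEisensteinDataCMThree

section CM

variable (L : Type) [Field L] [NumberField L] [IsCMField L]
  [MeasurableSpace (quasiSplit (↥(maximalRealSubfield L)) L (IsCMField.complexConj L) 3).Adelic] [BorelSpace (quasiSplit (↥(maximalRealSubfield L)) L (IsCMField.complexConj L) 3).Adelic]

/-- **X1_χ §2a AT `N = 3` — THE CONSTANT-TERM DATA OF THE `(χ₁, χ₂)` BALL SYSTEM OF `U(2,1)_{L∕L⁺}` AT THE CM PAIR** (module docstring): on `D_n = ball 0 (n+2)` (weight `n+4`, any level `a > 0`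
below the ι-threshold; here the consumer's `a`, with `hb := iotaBound_cm_three …`), the package `∃ hb α₁ col eX` with — `α₁ z =ᵐ zFun (f_z^φ)` and `col j z =ᵐ zFun (f^{φ′_j}_{2−z})` on `D_n`, both
HOLOMORPHIC there, `L(z) := Σ_j proj_j.smulRight (col j z)` HOLOMORPHIC on `D_n` and INJECTIVE on `D_n ∩ {2 < Re}`, the Godement agreement `eX z =ᵐ [E(f_z^φ)]` and the α-SYSTEM
`cnst_N(ι(eX z)) = 1 • α₁ z + L(z)(bX z)` for `z ∈ D_n`, `2 < Re z`.  Section data in the PAIR currency: `φ` a continuous bounded `(χ₁, χ₂)`-section, `χ₂` automorphic; `φ′_j` linearly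
independent continuous bounded `(χ₁′, χ₂′)`-sections, `χ₂′` automorphic (e.g. `(χ₁′, χ₂′) = (reflectChar c χ₁, χ₂)`); `bX` the coordinates of `(ν𝓕)⁻¹·φ̃_z·H^{z−2}`.  Letters: NONE beyond the
structural binders and the coordinate identity `hbX`. [cite: BernsteinLapid2019, §4 Claims 2 and 5, p. 10] [cite: MoeglinWaldspurger1995, II.1.7, IV.1.8] -/
theorem exists_chiPair_constantTerm_data_cm_three
    (μ : Measure (quasiSplit (↥(maximalRealSubfield L)) L (IsCMField.complexConj L) 3).automorphicQuotient) [(quasiSplit (↥(maximalRealSubfield L)) L (IsCMField.complexConj L) 3).IsAutomorphicMeasure μ]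
    (νG : Measure (quasiSplit (↥(maximalRealSubfield L)) L (IsCMField.complexConj L) 3).Adelic) [νG.IsHaarMeasure] [νG.IsInvInvariant] [SFinite νG]
    (ν : Measure ↥(adelicUnipotent (↥(maximalRealSubfield L)) L (IsCMField.complexConj L) 3)) [ν.IsHaarMeasure] [ν.IsMulRightInvariant] [ν.IsInvInvariant]
    {𝓕 : Set ↥(adelicUnipotent (↥(maximalRealSubfield L)) L (IsCMField.complexConj L) 3)}
    (h𝓕N : IsFundamentalDomain ↥(rationalUnipotent (↥(maximalRealSubfield L)) L (IsCMField.complexConj L) 3) 𝓕 ν) (h𝓕c : IsCompact (closure 𝓕)) (h𝓕₀ : ν 𝓕 ≠ 0)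
    {β : (quasiSplit (↥(maximalRealSubfield L)) L (IsCMField.complexConj L) 3).Adelic → ℝ≥0∞}
    (hβ : IsCoveringWeight ↥((arithmeticBorel (↥(maximalRealSubfield L)) L (IsCMField.complexConj L) 3).map (quasiSplit (↥(maximalRealSubfield L)) L (IsCMField.complexConj L) 3).arithmeticSubgroup.subtype) β)
    {μZ : Measure (borelQuotient (↥(maximalRealSubfield L)) L (IsCMField.complexConj L) 3)} [SFinite μZ]
    (hμZ : ∀ f : borelQuotient (↥(maximalRealSubfield L)) L (IsCMField.complexConj L) 3 → ℝ≥0∞, Measurable f → ∫⁻ z, f z ∂μZ = ∫⁻ g, β g * f (toBorelQuotient (↥(maximalRealSubfield L)) L (IsCMField.complexConj L) 3 g) ∂νG)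
    (n : ℕ) {a : ℝ≥0} (ha : 0 < a)
    -- the section data, PAIR currency: `φ` a continuous bounded `(χ₁, χ₂)`-section (`χ₂` automorphic), a linearly independent family of continuous bounded `(χ₁′, χ₂′)`-sections `φ′_j`
    -- (`χ₂′` automorphic), and the coordinates `bX` of `(ν𝓕)⁻¹·φ̃_z·H^{z−2}`
    {χ₁ : HeckeCharacter L} {χ₂ : ↥(TorusDict.torus (IsCMField.complexConj L)) →ₜ* ℂˣ} (hχ₂ : TorusDict.IsAutomorphic (IsCMField.complexConj L) χ₂)
    {φ : (quasiSplit (↥(maximalRealSubfield L)) L (IsCMField.complexConj L) 3).Adelic → ℂ} (hφ : IsChiSectionPair χ₁ χ₂ φ) (hφc : Continuous φ) {Mφ : ℝ} (hφM : ∀ x, ‖φ x‖ ≤ Mφ)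
    {χ₁' : HeckeCharacter L} {χ₂' : ↥(TorusDict.torus (IsCMField.complexConj L)) →ₜ* ℂˣ} (hχ₂' : TorusDict.IsAutomorphic (IsCMField.complexConj L) χ₂')
    {ι' : Type} [Fintype ι'] {φ' : ι' → (quasiSplit (↥(maximalRealSubfield L)) L (IsCMField.complexConj L) 3).Adelic → ℂ} (hli : LinearIndependent ℂ φ') (hφ'c : ∀ j, Continuous (φ' j))
    (hφ'χ : ∀ j, IsChiSectionPair χ₁' χ₂' (φ' j)) {Mb : ℝ} (hφ'M : ∀ j x, ‖φ' j x‖ ≤ Mb)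
    (bX : ℂ → ι' → ℂ)
    (hbX : ∀ z ∈ Metric.ball (0 : ℂ) (n + 2), 2 < z.re → (∑ j, bX z j • φ' j) = ((((ν 𝓕).toReal⁻¹ : ℝ)) : ℂ) • (fun g : (quasiSplit (↥(maximalRealSubfield L)) L (IsCMField.complexConj L) 3).Adelic => (∫ v : ↥(adelicUnipotent (↥(maximalRealSubfield L)) L (IsCMField.complexConj L) 3), flatSectionU φ z ((quasiSplit (↥(maximalRealSubfield L)) L (IsCMField.complexConj L) 3).toAdelic (weylLongU ((IsCMField.complexConj L : L ≃ₐ[↥(maximalRealSubfield L)] L) : L →+* L) (rfl : (StdForm.antidiagonal 3).over L = (StdForm.antidiagonal 3).over L)) * ((v : (quasiSplit (↥(maximalRealSubfield L)) L (IsCMField.complexConj L) 3).Adelic) * g)) ∂ν) * (((borelHeight g : ℝ) : ℂ) ^ (z - 2)))) :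
    ∃ (hb : IotaBound (↥(maximalRealSubfield L)) L (IsCMField.complexConj L) 3 (n + 4) a μ μZ) (α₁ : ℂ → HN (↥(maximalRealSubfield L)) L (IsCMField.complexConj L) 3 (n + 4) a μZ) (col : ι' → ℂ → HN (↥(maximalRealSubfield L)) L (IsCMField.complexConj L) 3 (n + 4) a μZ) (eX : ℂ → HX (↥(maximalRealSubfield L)) L (IsCMField.complexConj L) 3 (n + 4) μ),
      (∀ z ∈ Metric.ball (0 : ℂ) (n + 2), (α₁ z : borelQuotient (↥(maximalRealSubfield L)) L (IsCMField.complexConj L) 3 → ℂ) =ᵐ[weightedTruncMeasure (↥(maximalRealSubfield L)) L (IsCMField.complexConj L) 3 (n + 4) a μZ] zFun (↥(maximalRealSubfield L)) L (IsCMField.complexConj L) 3 (flatSectionU φ z)) ∧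
      DifferentiableOn ℂ α₁ (Metric.ball (0 : ℂ) (n + 2)) ∧
      (∀ j, ∀ z ∈ Metric.ball (0 : ℂ) (n + 2), (col j z : borelQuotient (↥(maximalRealSubfield L)) L (IsCMField.complexConj L) 3 → ℂ) =ᵐ[weightedTruncMeasure (↥(maximalRealSubfield L)) L (IsCMField.complexConj L) 3 (n + 4) a μZ] zFun (↥(maximalRealSubfield L)) L (IsCMField.complexConj L) 3 (flatSectionU (φ' j) (2 - z))) ∧
      (∀ j, DifferentiableOn ℂ (col j) (Metric.ball (0 : ℂ) (n + 2))) ∧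
      DifferentiableOn ℂ (fun z => (∑ j, (ContinuousLinearMap.proj (R := ℂ) (φ := fun _ : ι' => ℂ) j).smulRight (col j z) : (ι' → ℂ) →L[ℂ] HN (↥(maximalRealSubfield L)) L (IsCMField.complexConj L) 3 (n + 4) a μZ)) (Metric.ball (0 : ℂ) (n + 2)) ∧
      (∀ z ∈ Metric.ball (0 : ℂ) (n + 2), 2 < z.re → Function.Injective ((∑ j, (ContinuousLinearMap.proj (R := ℂ) (φ := fun _ : ι' => ℂ) j).smulRight (col j z) : (ι' → ℂ) →L[ℂ] HN (↥(maximalRealSubfield L)) L (IsCMField.complexConj L) 3 (n + 4) a μZ) : (ι' → ℂ) → HN (↥(maximalRealSubfield L)) L (IsCMField.complexConj L) 3 (n + 4) a μZ)) ∧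
      (∀ z ∈ Metric.ball (0 : ℂ) (n + 2), 2 < z.re → ((eX z : HX (↥(maximalRealSubfield L)) L (IsCMField.complexConj L) 3 (n + 4) μ) : (quasiSplit (↥(maximalRealSubfield L)) L (IsCMField.complexConj L) 3).automorphicQuotient → ℂ) =ᵐ[(μ.withDensity fun x => (((supHeight (↥(maximalRealSubfield L)) L (IsCMField.complexConj L) 3 x)⁻¹ ^ (2 * (n + 4)) : ℝ≥0) : ℝ≥0∞))] (quasiSplit (↥(maximalRealSubfield L)) L (IsCMField.complexConj L) 3).quotFun (eisensteinSeriesU (flatSectionU φ z))) ∧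
      (∀ z ∈ Metric.ball (0 : ℂ) (n + 2), 2 < z.re → cnstN (↥(maximalRealSubfield L)) L (IsCMField.complexConj L) 3 (n + 4) a μZ (iota hb (eX z)) = (1 : ℂ) • α₁ z + (∑ j, (ContinuousLinearMap.proj (R := ℂ) (φ := fun _ : ι' => ℂ) j).smulRight (col j z) : (ι' → ℂ) →L[ℂ] HN (↥(maximalRealSubfield L)) L (IsCMField.complexConj L) 3 (n + 4) a μZ) (bX z)) := by
  have hc : IsCMField.complexConj L * IsCMField.complexConj L = 1 := AlgEquiv.ext fun x => by rw [AlgEquiv.mul_apply, AlgEquiv.one_apply, IsCMField.complexConj_apply_apply]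
  have hc1 : IsCMField.complexConj L ≠ 1 := IsCMField.complexConj_ne_one L
  have h𝓕top : ν 𝓕 ≠ ∞ := ((measure_mono subset_closure).trans_lt h𝓕c.measure_lt_top).ne
  haveI : νG.IsMulRightInvariant := by rw [← Measure.inv_eq_self νG]; infer_instance
  have hb : IotaBound (↥(maximalRealSubfield L)) L (IsCMField.complexConj L) 3 (n + 4) a μ μZ := iotaBound_cm_three L μ νG hβ hμZ ha (n + 4)
  have hfin : μZ {z | a < borelQuotHeight (↥(maximalRealSubfield L)) L (IsCMField.complexConj L) 3 z} ≠ ∞ := measure_setOf_lt_ne_top_cm_three L μ νG hβ hμZ ha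
  haveI : IsFiniteMeasure (weightedTruncMeasure (↥(maximalRealSubfield L)) L (IsCMField.complexConj L) 3 (n + 4) a μZ) := isFiniteMeasure_weightedTruncMeasure_cm_three L μ νG hβ hμZ ha (n + 4)
  have hD : IsOpen (Metric.ball (0 : ℂ) (n + 2)) := Metric.isOpen_ball
  have hre : ∀ z ∈ Metric.ball (0 : ℂ) (n + 2), |z.re| < n + 2 := fun z hz => lt_of_le_of_lt (Complex.abs_re_le_norm z) (by rwa [Metric.mem_ball, dist_zero_right] at hz)
  have hk : ((n : ℝ) + 2) ≤ ((n + 4 : ℕ) : ℝ) := by push_cast; linarith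
  have h2re : ∀ z : ℂ, ((2 : ℂ) - z).re = 2 - z.re := fun z => by simp
  -- the invariances of the sections (★ DEFS LEAF, pair currency; `χ₂`, `χ₂′` automorphic)
  have hφB : ∀ γ ∈ ratBorelSubgroup (↥(maximalRealSubfield L)) L (IsCMField.complexConj L) 3, ∀ g, φ (γ * g) = φ g := ratBorel_mul_of_isChiSectionPair hφ hχ₂
  have hφ'B : ∀ j, ∀ γ ∈ ratBorelSubgroup (↥(maximalRealSubfield L)) L (IsCMField.complexConj L) 3, ∀ g, φ' j (γ * g) = φ' j g := fun j => ratBorel_mul_of_isChiSectionPair (hφ'χ j) hχ₂'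
  -- square-integrability of the `Z`-lifts on the ball (★ §1 of the `N = 2` file, rank-generic)
  have hm₁ : ∀ z ∈ Metric.ball (0 : ℂ) (n + 2), MemLp (zFun (↥(maximalRealSubfield L)) L (IsCMField.complexConj L) 3 (flatSectionU φ z)) 2 (weightedTruncMeasure (↥(maximalRealSubfield L)) L (IsCMField.complexConj L) 3 (n + 4) a μZ) := fun z hz =>
    memLp_zFun_flatSectionU_of_norm_le (σ₀ := -((n : ℝ) + 2)) (σ₁ := (n : ℝ) + 2) ha hfin (by push_cast; linarith) hk hφc.measurable hφB hφM
      ⟨by linarith [(abs_lt.1 (hre z hz)).1], by linarith [(abs_lt.1 (hre z hz)).2]⟩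
  have hm₂ : ∀ j, ∀ z ∈ Metric.ball (0 : ℂ) (n + 2), MemLp (zFun (↥(maximalRealSubfield L)) L (IsCMField.complexConj L) 3 (flatSectionU (φ' j) (2 - z))) 2 (weightedTruncMeasure (↥(maximalRealSubfield L)) L (IsCMField.complexConj L) 3 (n + 4) a μZ) := fun j z hz =>
    memLp_zFun_flatSectionU_of_norm_le (σ₀ := -(n : ℝ)) (σ₁ := (n : ℝ) + 4) ha hfin (by push_cast; linarith) (by push_cast; linarith) (hφ'c j).measurable (hφ'B j) (hφ'M j)
      ⟨by rw [h2re]; linarith [(abs_lt.1 (hre z hz)).2], by rw [h2re]; linarith [(abs_lt.1 (hre z hz)).1]⟩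
  -- `α₁`, the columns, and their holomorphy (★ p859772, exponent maps `z` and `2 − z`)
  obtain ⟨α₁, hα₁⟩ : ∃ α₁ : ℂ → HN (↥(maximalRealSubfield L)) L (IsCMField.complexConj L) 3 (n + 4) a μZ, α₁ = fun z => if hz : z ∈ Metric.ball (0 : ℂ) (n + 2) then toHN (↥(maximalRealSubfield L)) L (IsCMField.complexConj L) 3 (n + 4) a μZ (flatSectionU φ z) (hm₁ z hz) else 0 := ⟨_, rfl⟩
  obtain ⟨col, hcol⟩ : ∃ col : ι' → ℂ → HN (↥(maximalRealSubfield L)) L (IsCMField.complexConj L) 3 (n + 4) a μZ, col = fun j z => if hz : z ∈ Metric.ball (0 : ℂ) (n + 2) then toHN (↥(maximalRealSubfield L)) L (IsCMField.complexConj L) 3 (n + 4) a μZ (flatSectionU (φ' j) (2 - z)) (hm₂ j z hz) else 0 := ⟨_, rfl⟩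
  have hα₁z : ∀ z (hz : z ∈ Metric.ball (0 : ℂ) (n + 2)), α₁ z = toHN (↥(maximalRealSubfield L)) L (IsCMField.complexConj L) 3 (n + 4) a μZ (flatSectionU φ z) (hm₁ z hz) := fun z hz => by rw [hα₁]; exact dif_pos hz
  have hcolz : ∀ j z (hz : z ∈ Metric.ball (0 : ℂ) (n + 2)), col j z = toHN (↥(maximalRealSubfield L)) L (IsCMField.complexConj L) 3 (n + 4) a μZ (flatSectionU (φ' j) (2 - z)) (hm₂ j z hz) := fun j z hz => by rw [hcol]; exact dif_pos hz
  have hα₁ae : ∀ z ∈ Metric.ball (0 : ℂ) (n + 2), (α₁ z : borelQuotient (↥(maximalRealSubfield L)) L (IsCMField.complexConj L) 3 → ℂ) =ᵐ[weightedTruncMeasure (↥(maximalRealSubfield L)) L (IsCMField.complexConj L) 3 (n + 4) a μZ] zFun (↥(maximalRealSubfield L)) L (IsCMField.complexConj L) 3 (flatSectionU φ z) := fun z hz => by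
    rw [hα₁z z hz]; exact coeFn_toHN (↥(maximalRealSubfield L)) L (IsCMField.complexConj L) 3 (n + 4) a μZ _ _
  have hcolae : ∀ j, ∀ z ∈ Metric.ball (0 : ℂ) (n + 2), (col j z : borelQuotient (↥(maximalRealSubfield L)) L (IsCMField.complexConj L) 3 → ℂ) =ᵐ[weightedTruncMeasure (↥(maximalRealSubfield L)) L (IsCMField.complexConj L) 3 (n + 4) a μZ] zFun (↥(maximalRealSubfield L)) L (IsCMField.complexConj L) 3 (flatSectionU (φ' j) (2 - z)) := fun j z hz => by
    rw [hcolz j z hz]; exact coeFn_toHN (↥(maximalRealSubfield L)) L (IsCMField.complexConj L) 3 (n + 4) a μZ _ _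
  have hα₁d : DifferentiableOn ℂ α₁ (Metric.ball (0 : ℂ) (n + 2)) :=
    differentiableOn_HN_of_ae_eq_zFun_flatSectionU (σ₀ := -((n : ℝ) + 2)) (σ₁ := (n : ℝ) + 2) ha hfin (by push_cast; linarith) hk hφc.measurable hφB hφM hD
      (fun z hz => ⟨by linarith [(abs_lt.1 (hre z hz)).1], by linarith [(abs_lt.1 (hre z hz)).2]⟩) hα₁ae
  have hcold : ∀ j, DifferentiableOn ℂ (col j) (Metric.ball (0 : ℂ) (n + 2)) := fun j =>
    differentiableOn_HN_of_ae_eq_mul_cpow (φ := fun z : ℂ => 2 - z) (σ₀ := -(n : ℝ)) (σ₁ := (n : ℝ) + 4) ha hfin (by push_cast; linarith) (by push_cast; linarith)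
      (measurable_zFun_of_measurable (hφ'c j).measurable (hφ'B j)).aestronglyMeasurable (norm_zFun_le (hφ'M j)) hD (differentiableOn_id.const_sub (2 : ℂ))
      (fun z hz => by rw [h2re]; exact ⟨by linarith [(abs_lt.1 (hre z hz)).2], by linarith [(abs_lt.1 (hre z hz)).1]⟩)
      (fun z hz => by rw [← zFun_flatSectionU]; exact hcolae j z hz)
  -- the coordinate family `L z = Σ_j proj_j.smulRight (col j z)`: holomorphic (bounded bilinear device `smulRightL`) and injective on the Godement part (★ row 5 `hLinj_cm_three_pair`)
  have hLd : DifferentiableOn ℂ (fun z => (∑ j, (ContinuousLinearMap.proj (R := ℂ) (φ := fun _ : ι' => ℂ) j).smulRight (col j z) : (ι' → ℂ) →L[ℂ] HN (↥(maximalRealSubfield L)) L (IsCMField.complexConj L) 3 (n + 4) a μZ)) (Metric.ball (0 : ℂ) (n + 2)) := by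
    refine DifferentiableOn.fun_sum fun j _ => ?_
    have hj : (fun z => ((ContinuousLinearMap.proj (R := ℂ) (φ := fun _ : ι' => ℂ) j).smulRight (col j z) : (ι' → ℂ) →L[ℂ] HN (↥(maximalRealSubfield L)) L (IsCMField.complexConj L) 3 (n + 4) a μZ)) =
        fun z => ContinuousLinearMap.smulRightL ℂ (ι' → ℂ) (HN (↥(maximalRealSubfield L)) L (IsCMField.complexConj L) 3 (n + 4) a μZ) (ContinuousLinearMap.proj (R := ℂ) (φ := fun _ : ι' => ℂ) j) (col j z) := rfl
    rw [hj]
    exact (ContinuousLinearMap.smulRightL ℂ (ι' → ℂ) (HN (↥(maximalRealSubfield L)) L (IsCMField.complexConj L) 3 (n + 4) a μZ) (ContinuousLinearMap.proj (R := ℂ) (φ := fun _ : ι' => ℂ) j)).differentiable.comp_differentiableOn (hcold j)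
  have hLinj := hLinj_cm_three_pair L νG hβ hμZ hχ₂' hli hφ'c hφ'χ (2 : ℝ) n (n + 4) (w := fun z : ℂ => 2 - z) (α := col) (fun j z hz _ => hcolae j z hz)
  -- the Eisenstein datum `eX z = toHX E(f_z^φ)` on the Godement part of the ball (★ row 3, section-generic and `δ`-free), zero elsewhere
  have hzk : ∀ z ∈ Metric.ball (0 : ℂ) (n + 2), z.re ≤ ((n + 4 : ℕ) : ℝ) := fun z hz => by
    have h1 : z.re ≤ ‖z‖ := Complex.re_le_norm z
    have h2 : ‖z‖ < n + 2 := mem_ball_zero_iff.1 hz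
    push_cast
    linarith
  have hE : ∀ z : ℂ, z ∈ Metric.ball (0 : ℂ) (n + 2) ∧ 2 < z.re → MemLp ((quasiSplit (↥(maximalRealSubfield L)) L (IsCMField.complexConj L) 3).quotFun (eisensteinSeriesU (flatSectionU φ z))) 2 (μ.withDensity fun x => (((supHeight (↥(maximalRealSubfield L)) L (IsCMField.complexConj L) 3 x)⁻¹ ^ (2 * (n + 4)) : ℝ≥0) : ℝ≥0∞)) := fun z hz =>
    eisensteinSeriesU_flatSectionU_memHX_of_norm_le_cm_three L ν h𝓕N h𝓕c μ hφc hφM (hφ.toAdelic_mul hχ₂) (n + 4) hz.2 (hzk z hz.1)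
  obtain ⟨eX, heX⟩ : ∃ eX : ℂ → HX (↥(maximalRealSubfield L)) L (IsCMField.complexConj L) 3 (n + 4) μ, eX = fun z => if hz : z ∈ Metric.ball (0 : ℂ) (n + 2) ∧ 2 < z.re then toHX (↥(maximalRealSubfield L)) L (IsCMField.complexConj L) 3 (n + 4) μ (eisensteinSeriesU (flatSectionU φ z)) (hE z hz) else 0 := ⟨_, rfl⟩
  have heXz : ∀ z (hz : z ∈ Metric.ball (0 : ℂ) (n + 2) ∧ 2 < z.re), eX z = toHX (↥(maximalRealSubfield L)) L (IsCMField.complexConj L) 3 (n + 4) μ (eisensteinSeriesU (flatSectionU φ z)) (hE z hz) := fun z hz => by rw [heX]; exact dif_pos hz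
  -- the disintegration letter of S2 (★ unfolding, `hconj` ★ at `N = 3`)
  have hdis' : ∀ Φ : (quasiSplit (↥(maximalRealSubfield L)) L (IsCMField.complexConj L) 3).Adelic → ℂ, Measurable Φ → (∀ b ∈ ratBorelSubgroup (↥(maximalRealSubfield L)) L (IsCMField.complexConj L) 3, ∀ g, Φ (b * g) = Φ g) →
      Integrable (zFun (↥(maximalRealSubfield L)) L (IsCMField.complexConj L) 3 Φ) (weightedTruncMeasure (↥(maximalRealSubfield L)) L (IsCMField.complexConj L) 3 (n + 4) a μZ) → Integrable (zFun (↥(maximalRealSubfield L)) L (IsCMField.complexConj L) 3 (borelConstantTerm ν 𝓕 Φ)) (weightedTruncMeasure (↥(maximalRealSubfield L)) L (IsCMField.complexConj L) 3 (n + 4) a μZ) →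
        ∫ x, zFun (↥(maximalRealSubfield L)) L (IsCMField.complexConj L) 3 (borelConstantTerm ν 𝓕 Φ) x ∂(weightedTruncMeasure (↥(maximalRealSubfield L)) L (IsCMField.complexConj L) 3 (n + 4) a μZ) = ∫ x, zFun (↥(maximalRealSubfield L)) L (IsCMField.complexConj L) 3 Φ x ∂(weightedTruncMeasure (↥(maximalRealSubfield L)) L (IsCMField.complexConj L) 3 (n + 4) a μZ) := fun Φ hΦm hΦB hint hint' =>
    integral_zFun_borelConstantTerm_eq_of_unfolding νG ν (fun _ hb₀ => map_conj_toAdelic_eq_self_three hc hc1 ν hb₀) h𝓕N h𝓕₀ h𝓕top hβ hμZ (n + 4) a hΦm hΦB hint hint'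
  -- square-integrability of the intertwined coefficient's column, through the coordinate identity `hbX`
  have hflat : ∀ (b : ι' → ℂ) (w : ℂ), flatSectionU (∑ j, b j • φ' j) w = ∑ j, b j • flatSectionU (φ' j) w := fun b w => by
    funext g
    simp only [flatSectionU_apply, Finset.sum_apply, Pi.smul_apply, smul_eq_mul, Finset.sum_mul, mul_assoc]
  have hcne : ((((ν 𝓕).toReal⁻¹ : ℝ)) : ℂ) ≠ 0 := Complex.ofReal_ne_zero.2 (inv_ne_zero (ENNReal.toReal_pos h𝓕₀ h𝓕top).ne')
  have hsum2 : ∀ z ∈ Metric.ball (0 : ℂ) (n + 2), MemLp (zFun (↥(maximalRealSubfield L)) L (IsCMField.complexConj L) 3 (flatSectionU (∑ j, bX z j • φ' j) (2 - z))) 2 (weightedTruncMeasure (↥(maximalRealSubfield L)) L (IsCMField.complexConj L) 3 (n + 4) a μZ) := fun z hz => by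
    rw [hflat, zFun_sum_smul]
    exact memLp_finsetSum _ fun j _ => (hm₂ j z hz).const_mul _
  have hm₃ : ∀ z (hz : z ∈ Metric.ball (0 : ℂ) (n + 2) ∧ 2 < z.re), MemLp (zFun (↥(maximalRealSubfield L)) L (IsCMField.complexConj L) 3 (flatSectionU (fun g : (quasiSplit (↥(maximalRealSubfield L)) L (IsCMField.complexConj L) 3).Adelic => (∫ v : ↥(adelicUnipotent (↥(maximalRealSubfield L)) L (IsCMField.complexConj L) 3), flatSectionU φ z ((quasiSplit (↥(maximalRealSubfield L)) L (IsCMField.complexConj L) 3).toAdelic (weylLongU ((IsCMField.complexConj L : L ≃ₐ[↥(maximalRealSubfield L)] L) : L →+* L) (rfl : (StdForm.antidiagonal 3).over L = (StdForm.antidiagonal 3).over L)) * ((v : (quasiSplit (↥(maximalRealSubfield L)) L (IsCMField.complexConj L) 3).Adelic) * g)) ∂ν) * (((borelHeight g : ℝ) : ℂ) ^ (z - 2))) (2 - z))) 2 (weightedTruncMeasure (↥(maximalRealSubfield L)) L (IsCMField.complexConj L) 3 (n + 4) a μZ) := fun z hz => by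
    have hfun : zFun (↥(maximalRealSubfield L)) L (IsCMField.complexConj L) 3 (flatSectionU (fun g : (quasiSplit (↥(maximalRealSubfield L)) L (IsCMField.complexConj L) 3).Adelic => (∫ v : ↥(adelicUnipotent (↥(maximalRealSubfield L)) L (IsCMField.complexConj L) 3), flatSectionU φ z ((quasiSplit (↥(maximalRealSubfield L)) L (IsCMField.complexConj L) 3).toAdelic (weylLongU ((IsCMField.complexConj L : L ≃ₐ[↥(maximalRealSubfield L)] L) : L →+* L) (rfl : (StdForm.antidiagonal 3).over L = (StdForm.antidiagonal 3).over L)) * ((v : (quasiSplit (↥(maximalRealSubfield L)) L (IsCMField.complexConj L) 3).Adelic) * g)) ∂ν) * (((borelHeight g : ℝ) : ℂ) ^ (z - 2))) (2 - z)) = fun x => (((((ν 𝓕).toReal⁻¹ : ℝ)) : ℂ))⁻¹ * zFun (↥(maximalRealSubfield L)) L (IsCMField.complexConj L) 3 (flatSectionU (∑ j, bX z j • φ' j) (2 - z)) x := by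
      funext x
      rw [hbX z hz.1 hz.2]
      simp only [zFun_flatSectionU, zFun_smul, Pi.smul_apply, smul_eq_mul]
      rw [mul_assoc (((((ν 𝓕).toReal⁻¹ : ℝ)) : ℂ)), ← mul_assoc (((((ν 𝓕).toReal⁻¹ : ℝ)) : ℂ))⁻¹, inv_mul_cancel₀ hcne, one_mul]
    rw [hfun]
    exact (hsum2 z hz.1).const_mul _
  -- the α-system on the Godement part: ★ row 4b S2_χ with ★ row 2's constant term
  have hsolC : ∀ z ∈ Metric.ball (0 : ℂ) (n + 2), ∀ hz1 : 2 < z.re,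
      cnstN (↥(maximalRealSubfield L)) L (IsCMField.complexConj L) 3 (n + 4) a μZ (iota hb (eX z)) = (1 : ℂ) • α₁ z + (∑ j, (ContinuousLinearMap.proj (R := ℂ) (φ := fun _ : ι' => ℂ) j).smulRight (col j z) : (ι' → ℂ) →L[ℂ] HN (↥(maximalRealSubfield L)) L (IsCMField.complexConj L) 3 (n + 4) a μZ) (bX z) := by
    intro z hz hz1
    have hct : ∀ g : (quasiSplit (↥(maximalRealSubfield L)) L (IsCMField.complexConj L) 3).Adelic, borelConstantTerm ν 𝓕 (eisensteinSeriesU (flatSectionU φ z)) g = flatSectionU φ z g + ((((ν 𝓕).toReal⁻¹ : ℝ)) : ℂ) *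
        ∫ v : ↥(adelicUnipotent (↥(maximalRealSubfield L)) L (IsCMField.complexConj L) 3), flatSectionU φ z ((quasiSplit (↥(maximalRealSubfield L)) L (IsCMField.complexConj L) 3).toAdelic (weylLongU ((IsCMField.complexConj L : L ≃ₐ[↥(maximalRealSubfield L)] L) : L →+* L) (rfl : (StdForm.antidiagonal 3).over L = (StdForm.antidiagonal 3).over L)) * ((v : (quasiSplit (↥(maximalRealSubfield L)) L (IsCMField.complexConj L) 3).Adelic) * g)) ∂ν := fun g =>
      borelConstantTerm_chiPairEisenstein_cm_three_eq_add_mul L ν h𝓕N h𝓕c hχ₂ hφ hφc hφM hz1 g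
    have hS2 := cnstN_iota_toHX_eisensteinSeriesU_eq_chi_cm_three L ν h𝓕N hb hdis' (hφ.toAdelic_mul hχ₂) hφc hφM hz1 hct (hE z ⟨hz, hz1⟩) (hm₁ z hz) (hm₃ z ⟨hz, hz1⟩)
    rw [heXz z ⟨hz, hz1⟩, hS2, one_smul, hα₁z z hz]
    congr 1
    -- `c • toHN (flatSectionU φ̃ (2−z)) = Σ_j bX z j • col j z` in `𝓗_k(Z_a)`, read a.e.
    have hLapp : (∑ j, (ContinuousLinearMap.proj (R := ℂ) (φ := fun _ : ι' => ℂ) j).smulRight (col j z) : (ι' → ℂ) →L[ℂ] HN (↥(maximalRealSubfield L)) L (IsCMField.complexConj L) 3 (n + 4) a μZ) (bX z) = ∑ j, bX z j • col j z := by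
      simp only [FunLike.coe_sum, Finset.sum_apply, ContinuousLinearMap.smulRight_apply, ContinuousLinearMap.proj_apply]
    rw [hLapp]
    refine Lp.ext ?_
    refine (Lp.coeFn_smul _ _).trans ?_
    refine EventuallyEq.trans ?_ (coeFn_sum_smul_ae_eq Finset.univ (bX z) (fun j => col j z)).symm
    have hcols : ∀ᵐ x ∂(weightedTruncMeasure (↥(maximalRealSubfield L)) L (IsCMField.complexConj L) 3 (n + 4) a μZ), ∀ j, (col j z : borelQuotient (↥(maximalRealSubfield L)) L (IsCMField.complexConj L) 3 → ℂ) x = zFun (↥(maximalRealSubfield L)) L (IsCMField.complexConj L) 3 (flatSectionU (φ' j) (2 - z)) x :=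
      ae_all_iff.2 fun j => hcolae j z hz
    filter_upwards [coeFn_toHN (↥(maximalRealSubfield L)) L (IsCMField.complexConj L) 3 (n + 4) a μZ _ (hm₃ z ⟨hz, hz1⟩), hcols] with x hx hxs
    rw [Pi.smul_apply, hx, smul_eq_mul]
    simp only [hxs]
    have hsum := congrFun (zFun_sum_smul Finset.univ (bX z) (fun j => flatSectionU (φ' j) (2 - z))) x
    rw [← hflat] at hsum
    rw [← hsum, hbX z hz hz1]
    simp only [zFun_flatSectionU, zFun_smul, Pi.smul_apply, smul_eq_mul, mul_assoc]
  refine ⟨hb, α₁, col, eX, hα₁ae, hα₁d, hcolae, hcold, hLd, hLinj, fun z hz hz1 => ?_, fun z hz hz1 => hsolC z hz hz1⟩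
  rw [heXz z ⟨hz, hz1⟩]
  exact MemLp.coeFn_toLp _

end CM

end Summit.HodgeConjecture.HodgeConjecture.Cruxes.H413.K2E1ChiEisensteinDataCMThree

end
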